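import Summits.QuantumFields.BalabanUV.Gaps.D1ReynoldsMeanPairs

/-!
# `BalabanUV.Gaps.D1ReynoldsMeanDrift` — cell pub-balaban-gaps, row (D1), seat g1-p1: THE ONE-LOOP DRIFT LAW IS CONVEX — (D1) AT THE SIX UNORDERED CHANNELS OF EITHER LITERAL IMPLIES THE
# (D1)-DRIFT LAW (same slope `stepBal N Lc`) FOR THE (1.22) COEFFICIENT OF THE S₄-REYNOLDS MEAN OF ITS KERNELS; conversely, under the printed (1.21) for the literal, the mean IS the
# literal's kernel, so the two readings coincide

HONEST FRAMING (cell rule, page 1 of everything): [folklore] kernel algebra BY NAME — an4's `Drift.OneLoopDrift` (the cell's (T-drift), NOT in print), GEN 14's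
`D1ReynoldsMeanPairs.six_mul_secondMoment_reynoldsMean_…`, leaf-01 g37's `reynoldsMean ∕ reynoldsMean_eq_self`, an4's `secondMoment_flipK`.  Which literal the β row wants (one-comb,
Reynolds-mean kernel, pair-averaged `hβ`) is the OWNER's ruling (Q-an2-g55-1) — this file only records how the candidate readings of (D1) relate, AS ALGEBRA ONLY.  BY-VALUE STATUS OF
RECORD (the b2b lane, located, zero weight here): for the (III′) literal `PermCovariant` FAILS by value (Engine C LITCOV) and the Reynolds-mean reading is the EXCLUDED exit (L1) (it misses
β⁰^{(0.4)} by +25.7 % ∕ +16.7 %; leaf-01 N-4, pub-balaban journal l.61906; leaf-01 g40 W-3 l.62644) — so every `…_of_permCovariant_JsB12CombShSym` below has a hypothesis that is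
displayed-open in the kernel and reported FALSE by value; for the pinned literal (1.21) is unscreened.  NOTHING of Bałaban's asserted; NO coefficient computed or signed; (D1) NOT
discharged for any literal; 0∕4 row-D1 binders; NOT `BetaPertH`, NOT continuum, NOT Clay.
HONEST DEPENDENCY (b2b cell, verbatim): «continuum YM on T⁴ ⇐ BetaPertH ∧ nine spine estimates (0/9 proved); BetaPertH ⇐ (D1) ∧ (D4) ∧ CAP+tail; G-an2-4 gates asym, D1 and NE2/3/4.»

CONTENT (all [folklore]; no `def`, 0 sorry): §1 generic — **`oneLoopDrift_finsetAverage`** (the drift law `∀ k, |Σ_{j<k} β_j − b·k| ≤ A` is preserved by finite averaging, constant = the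
average of the constants), the finset of the six pairs `a < b` of `Fin 4` (inlined; its cardinality `6` by `decide` inline — the tree's `OSLegsFromFemtoAndGap.card_planes` states it already), `sum_ite_lt_eq_sum_offDiagPairsLT`; §2 pinned literal — **`oneLoopDrift_reynoldsMean_JsBalAn1_of_six`**:
(D1)-drift at the six channels `a < b` (constants `A ab`) ⟹ (D1)-drift for `j ↦ secondMoment (reynoldsMean (flipK (TbalOf …) j)) μ ν` (`μ ≠ ν`, constant their average), and
**`d1Drift_six_to_reynoldsMean_JsBalAn1`** (from `D1Drift Lc (JsBalAn1 …) N a b` at the six channels); `secondMoment_reynoldsMean_eq_of_permCovariant_JsBalAn1` (under (1.21) the mean's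
coefficient IS `β⁰_j(μ,ν)`); §3 the same at the (III′) literal over every table record.

Provenance: cell pub-balaban-gaps, seat g1-p1 GEN 14 (prover-pub-balaban-gaps-g1-p1-g14-0), 2026-08-25; imports `Gaps/D1ReynoldsMeanPairs` (p391079 ✓) only; no existing file touched.
-/

noncomputable section

open Literature.MathematicalPhysics.QuantumFieldTheory Balaban1983to89 Balaban1983to89.Beta Filter Topology
open OneStepResolventKernel (JetData)
open OneStepKernelFamily (TbalOf flipK D1Drift secondMoment_flipK)
open PolarizationSign (IndexSymmetric)
open Drift (OneLoopDrift)
open AffineAveraging (box)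
open Summit.QuantumFields.BalabanUV.Beta.SymmetrisedStepJets (SymTables)
open Summit.QuantumFields.BalabanUV.Beta.MixedJetTablesPlug (JsBalAn1)
open Summit.QuantumFields.BalabanUV.Beta.CombChartJointEnd (JsB12CombShSym)
open Summit.QuantumFields.BalabanUV.Beta.D1BFx.PermCovariantReynolds (reynoldsMean reynoldsMean_eq_self)
open Summit.QuantumFields.BalabanUV.Gaps.D1ReynoldsMeanPairs (six_mul_secondMoment_reynoldsMean_JsBalAn1 six_mul_secondMoment_reynoldsMean_JsB12CombShSym)

namespace Summit.QuantumFields.BalabanUV.Gaps.D1ReynoldsMeanDrift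

variable {Lc : ℕ} [NeZero Lc]

/-! ## §1 The drift law is preserved by finite averaging; the six unordered channel pairs of `Fin 4` -/

/-- [folklore] **THE ONE-LOOP DRIFT LAW IS CONVEX**: if every member `β i` (`i ∈ s`, `s` nonempty) obeys `OneLoopDrift b (A i) (β i)`, then the average `j ↦ (#s)⁻¹ Σ_{i∈s} β i j` obeys
`OneLoopDrift b ((#s)⁻¹ Σ_{i∈s} A i)`. -/
theorem oneLoopDrift_finsetAverage {ι : Type*} (s : Finset ι) (hs : s.Nonempty) {b : ℝ} {A : ι → ℝ} {β : ι → ℕ → ℝ}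
    (h : ∀ i ∈ s, OneLoopDrift b (A i) (β i)) :
    OneLoopDrift b (((s.card : ℝ))⁻¹ * ∑ i ∈ s, A i) (fun j => ((s.card : ℝ))⁻¹ * ∑ i ∈ s, β i j) := by
  intro k
  have hn : (0 : ℝ) < s.card := by exact_mod_cast hs.card_pos
  have hn' : (s.card : ℝ) ≠ 0 := hn.ne'
  have e : ∑ j ∈ Finset.range k, ((s.card : ℝ))⁻¹ * ∑ i ∈ s, β i j - b * k
      = ((s.card : ℝ))⁻¹ * ∑ i ∈ s, (∑ j ∈ Finset.range k, β i j - b * k) := by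
    rw [Finset.sum_sub_distrib, Finset.sum_comm, ← Finset.mul_sum, Finset.sum_const, nsmul_eq_mul]
    field_simp
  rw [e, abs_mul, abs_inv, abs_of_pos hn]
  refine mul_le_mul_of_nonneg_left ((Finset.abs_sum_le_sum_abs _ _).trans (Finset.sum_le_sum fun i hi => h i hi k)) (inv_nonneg.mpr hn.le)


/-- [folklore] The `if a < b` double sum is the sum over `(Finset.univ.filter fun p : Fin 4 × Fin 4 => p.1 < p.2)`. -/
theorem sum_ite_lt_eq_sum_offDiagPairsLT (f : Fin 4 → Fin 4 → ℝ) :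
    (∑ a : Fin 4, ∑ b : Fin 4, if a < b then f a b else 0) = ∑ p ∈ (Finset.univ.filter fun p : Fin 4 × Fin 4 => p.1 < p.2), f p.1 p.2 := by
  rw [Finset.sum_filter, Fintype.sum_prod_type]

/-! ## §2 The β-lead's pinned family -/

section Pinned

variable {r : Fin (3 + 1) → ℕ}

/-- [folklore] **(D1)-DRIFT AT THE SIX CHANNELS ⟹ (D1)-DRIFT FOR THE REYNOLDS-MEAN COEFFICIENT** (pinned literal; `μ ≠ ν`; slope `b` arbitrary, e.g. `stepBal N Lc`): if for every pair `a < b`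
the sequence `j ↦ secondMoment (TbalOf Lc (JsBalAn1 …) j) a b` obeys `OneLoopDrift b (A (a,b))`, then `j ↦ secondMoment (reynoldsMean (flipK (TbalOf Lc (JsBalAn1 …) j))) μ ν` obeys
`OneLoopDrift b (6⁻¹ · Σ_{a<b} A (a,b))` — `six_mul_secondMoment_reynoldsMean_JsBalAn1` + `secondMoment_flipK` + `oneLoopDrift_finsetAverage`. -/
theorem oneLoopDrift_reynoldsMean_JsBalAn1_of_six (hLc : 1 ≤ Lc) (hr : r ∈ box (3 + 1) Lc) (cE cVH cΛ cE₂ cB : ℝ) (T : Fin 4 → Fin 4 → Fin 4 → Fin 4 → ℝ)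
    {b : ℝ} {A : Fin 4 × Fin 4 → ℝ}
    (h : ∀ p ∈ (Finset.univ.filter fun p : Fin 4 × Fin 4 => p.1 < p.2), OneLoopDrift b (A p) (fun j => B12Beta.secondMoment (TbalOf Lc (JsBalAn1 hLc hr cE cVH cΛ cE₂ cB T) j) p.1 p.2))
    {μ ν : Fin 4} (hμν : μ ≠ ν) :
    OneLoopDrift b ((((Finset.univ.filter fun p : Fin 4 × Fin 4 => p.1 < p.2).card : ℝ))⁻¹ * ∑ p ∈ (Finset.univ.filter fun p : Fin 4 × Fin 4 => p.1 < p.2), A p)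
      (fun j => B12Beta.secondMoment (reynoldsMean (flipK (TbalOf Lc (JsBalAn1 hLc hr cE cVH cΛ cE₂ cB T) j))) μ ν) := by
  have hav := oneLoopDrift_finsetAverage (Finset.univ.filter fun p : Fin 4 × Fin 4 => p.1 < p.2) ⟨((0 : Fin 4), (1 : Fin 4)), by decide⟩ h
  refine fun k => (le_of_eq ?_).trans (hav k)
  congr 2
  refine Finset.sum_congr rfl fun j _ => ?_
  have h6 := six_mul_secondMoment_reynoldsMean_JsBalAn1 hLc hr cE cVH cΛ cE₂ cB T j hμν
  simp only [secondMoment_flipK] at h6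
  rw [sum_ite_lt_eq_sum_offDiagPairsLT] at h6
  rw [show (Finset.univ.filter fun p : Fin 4 × Fin 4 => p.1 < p.2).card = 6 from by decide]
  push_cast
  linarith

/-- [folklore] **THE BINDER AT THE SIX CHANNELS ⟹ THE BINDER's DRIFT LAW FOR THE REYNOLDS-MEAN COEFFICIENT** (pinned literal, numeral `N`, `μ ≠ ν`):
`(∀ a < b, D1Drift Lc (JsBalAn1 …) N a b) → ∃ A, OneLoopDrift (stepBal N Lc) A (j ↦ secondMoment (reynoldsMean (flipK (TbalOf …) j)) μ ν)` — a Reynolds-mean reading of (D1) is implied by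
(D1) at the six unordered channels (by `d1Drift_JsBalAn1_comm` the other six ordered channels add nothing). -/
theorem d1Drift_six_to_reynoldsMean_JsBalAn1 (hLc : 1 ≤ Lc) (hr : r ∈ box (3 + 1) Lc) (cE cVH cΛ cE₂ cB : ℝ) (T : Fin 4 → Fin 4 → Fin 4 → Fin 4 → ℝ) (N : ℝ)
    (h : ∀ p ∈ (Finset.univ.filter fun p : Fin 4 × Fin 4 => p.1 < p.2), D1Drift Lc (JsBalAn1 hLc hr cE cVH cΛ cE₂ cB T) N p.1 p.2) {μ ν : Fin 4} (hμν : μ ≠ ν) :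
    ∃ A : ℝ, OneLoopDrift (B12Normalization.stepBal N Lc) A
      (fun j => B12Beta.secondMoment (reynoldsMean (flipK (TbalOf Lc (JsBalAn1 hLc hr cE cVH cΛ cE₂ cB T) j))) μ ν) := by
  choose A hA using h
  exact ⟨_, oneLoopDrift_reynoldsMean_JsBalAn1_of_six hLc hr cE cVH cΛ cE₂ cB T (A := fun p => if hp : p ∈ (Finset.univ.filter fun p : Fin 4 × Fin 4 => p.1 < p.2) then A p hp else 0)
    (fun p hp => by simpa only [dif_pos hp] using hA p hp) hμν⟩

/-- [folklore] Under the printed (1.21) for the pinned literal's flipped kernel (a HYPOTHESIS, not manifest for this literal) the Reynolds mean IS the kernel, so its coefficient is `β⁰_j(μ,ν)`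
itself (`reynoldsMean_eq_self`, `secondMoment_flipK`) — the two readings of (D1) then coincide. -/
theorem secondMoment_reynoldsMean_eq_of_permCovariant_JsBalAn1 (hLc : 1 ≤ Lc) (hr : r ∈ box (3 + 1) Lc) (cE cVH cΛ cE₂ cB : ℝ) (T : Fin 4 → Fin 4 → Fin 4 → Fin 4 → ℝ) (j : ℕ)
    (hC : B12Beta.PermCovariant (flipK (TbalOf Lc (JsBalAn1 hLc hr cE cVH cΛ cE₂ cB T) j))) (μ ν : Fin 4) :
    B12Beta.secondMoment (reynoldsMean (flipK (TbalOf Lc (JsBalAn1 hLc hr cE cVH cΛ cE₂ cB T) j))) μ ν =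
      B12Beta.secondMoment (TbalOf Lc (JsBalAn1 hLc hr cE cVH cΛ cE₂ cB T) j) μ ν := by
  rw [reynoldsMean_eq_self hC, secondMoment_flipK]

end Pinned

/-! ## §3 The b2b wall's (III′) literal over every table record -/

/-- [folklore] **(D1)-DRIFT AT THE SIX CHANNELS ⟹ (D1)-DRIFT FOR THE REYNOLDS-MEAN COEFFICIENT** ((III′) literal, every table record; `μ ≠ ν`). -/
theorem oneLoopDrift_reynoldsMean_JsB12CombShSym_of_six (hLc : Odd Lc) (N : ℕ) (tabs : SymTables 3 Lc) (cΛ cB : ℝ) {b : ℝ} {A : Fin 4 × Fin 4 → ℝ}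
    (h : ∀ p ∈ (Finset.univ.filter fun p : Fin 4 × Fin 4 => p.1 < p.2), OneLoopDrift b (A p) (fun j => B12Beta.secondMoment (TbalOf Lc (JsB12CombShSym hLc N tabs cΛ cB) j) p.1 p.2))
    {μ ν : Fin 4} (hμν : μ ≠ ν) :
    OneLoopDrift b ((((Finset.univ.filter fun p : Fin 4 × Fin 4 => p.1 < p.2).card : ℝ))⁻¹ * ∑ p ∈ (Finset.univ.filter fun p : Fin 4 × Fin 4 => p.1 < p.2), A p)
      (fun j => B12Beta.secondMoment (reynoldsMean (flipK (TbalOf Lc (JsB12CombShSym hLc N tabs cΛ cB) j))) μ ν) := by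
  have hav := oneLoopDrift_finsetAverage (Finset.univ.filter fun p : Fin 4 × Fin 4 => p.1 < p.2) ⟨((0 : Fin 4), (1 : Fin 4)), by decide⟩ h
  refine fun k => (le_of_eq ?_).trans (hav k)
  congr 2
  refine Finset.sum_congr rfl fun j _ => ?_
  have h6 := six_mul_secondMoment_reynoldsMean_JsB12CombShSym hLc N tabs cΛ cB j hμν
  simp only [secondMoment_flipK] at h6
  rw [sum_ite_lt_eq_sum_offDiagPairsLT] at h6
  rw [show (Finset.univ.filter fun p : Fin 4 × Fin 4 => p.1 < p.2).card = 6 from by decide]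
  push_cast
  linarith

/-- [folklore] **THE BINDER AT THE SIX CHANNELS ⟹ THE BINDER's DRIFT LAW FOR THE REYNOLDS-MEAN COEFFICIENT** ((III′) literal, every table record, numeral `Nc`, `μ ≠ ν`). -/
theorem d1Drift_six_to_reynoldsMean_JsB12CombShSym (hLc : Odd Lc) (N : ℕ) (tabs : SymTables 3 Lc) (cΛ cB : ℝ) (Nc : ℝ)
    (h : ∀ p ∈ (Finset.univ.filter fun p : Fin 4 × Fin 4 => p.1 < p.2), D1Drift Lc (JsB12CombShSym hLc N tabs cΛ cB) Nc p.1 p.2) {μ ν : Fin 4} (hμν : μ ≠ ν) :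
    ∃ A : ℝ, OneLoopDrift (B12Normalization.stepBal Nc Lc) A
      (fun j => B12Beta.secondMoment (reynoldsMean (flipK (TbalOf Lc (JsB12CombShSym hLc N tabs cΛ cB) j))) μ ν) := by
  choose A hA using h
  exact ⟨_, oneLoopDrift_reynoldsMean_JsB12CombShSym_of_six hLc N tabs cΛ cB (A := fun p => if hp : p ∈ (Finset.univ.filter fun p : Fin 4 × Fin 4 => p.1 < p.2) then A p hp else 0)
    (fun p hp => by simpa only [dif_pos hp] using hA p hp) hμν⟩

/-- [folklore] Under (1.21) for the (III′) literal's flipped kernel the Reynolds mean IS the kernel: its coefficient is `β⁰_j(μ,ν)` itself.  ALGEBRA ONLY: the hypothesis `hC` is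
reported FALSE BY VALUE for this literal (Engine C LITCOV, leaf-01 N-4 l.61906); the lemma records what (1.21) would entail, not that it holds. -/
theorem secondMoment_reynoldsMean_eq_of_permCovariant_JsB12CombShSym (hLc : Odd Lc) (N : ℕ) (tabs : SymTables 3 Lc) (cΛ cB : ℝ) (j : ℕ)
    (hC : B12Beta.PermCovariant (flipK (TbalOf Lc (JsB12CombShSym hLc N tabs cΛ cB) j))) (μ ν : Fin 4) :
    B12Beta.secondMoment (reynoldsMean (flipK (TbalOf Lc (JsB12CombShSym hLc N tabs cΛ cB) j))) μ ν =
      B12Beta.secondMoment (TbalOf Lc (JsB12CombShSym hLc N tabs cΛ cB) j) μ ν := by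
  rw [reynoldsMean_eq_self hC, secondMoment_flipK]

end Summit.QuantumFields.BalabanUV.Gaps.D1ReynoldsMeanDrift

end
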